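import Summits.ResolutionOfSingularities.ResolutionOfSingularities.Theorems.PurelyInseparableDim4ResConeLightLossyStep
import HarnessLib
import HarnessLib.Audit.Tags

/-!
# Purely inseparable four-folds — on a LIGHT `(5,3)` binary-cone tail the FREE letter is never a kernel vector:
# a degenerate polar kernel `⟨e_hit, e_free⟩` persists by (I2) and makes every later step FREE, against FT
# (cell `res-dim4-pi`, K2(p) lane, slice C; light-lossy class = hN4-C, kernel seat res-dim4-p-1 g5, FILE 1 of 4)

[OURS · counted 0 · cell `res-dim4-pi` · K2(p) lane (holder res-dim4-p-12 g4, route of record «LIGHT-LOSSY = C13 ∘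
RE-PRESENTATION (hN4-C)», res-dim4-idea-1 g7 2026-08-29 06:24:43Z) · seat res-dim4-p-1 g5.]  Nothing here proves K2(5)
(`RidgeBudget.NoAboveFloorTrap 5 5`), `NoIsolatedTrap 5 5` or resolution of singularities in dimension ≥ 4 / characteristic
`p` — NOT proved.  AI kernel work, weaker than expert review.

Why this file.  The re-presentation of a light-lossy tail at the loss-free chart (FILES 2–4) needs the virtual translation
to be read off the polar kernel: the real direction `e_x + γ·e_Y` (one boundary letter `x` hit, `Y` free) is the ONLY point of
`resVertex (c k)` on the line `e_x + K·e_Y` unless the kernel is the DEGENERATE plane `⟨e_x, e_Y⟩`, i.e. unless `e_Y ∈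
resVertex (c k)`.  This file kills the degenerate case on its own, in the real (lossy or not) presentation:
* §1 `inf_hyperplane_eq_span_of_mem` — a plane of `K⁴` through `e_a` and `e_c` meets `{w_a = 0}` in the line `K·e_c`;
* §2 **`free_mem_resVertex_step`** — on the light tail (`light_step_cases` / `lossy_step_shape`, res-dim4-p-12 g4's L0): if the
  free letter `Y_k` has `e_{Y_k} ∈ resVertex (c k)`, then the kernel is `⟨e_{j k}, e_{Y_k}⟩` (loss-free step) resp.
  `⟨e_{Y_k}, e_x⟩` (lossy step translating `x`), so by (I2) `resVertex (c (k+1)) ∩ {w_{j k} = 0} = K·e_{Y_{k+1}}` with `Y_{k+1}`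
  the new free letter (`Y_k` resp. `x`) — in particular `e_{Y_{k+1}} ∈ resVertex (c (k+1))` again;
* §3 `not_isSatellite_of_free_mem_resVertex` — hence NO later step is a satellite (a satellite direction would be `e_{Y_{k+1}}`
  itself: the free chart with no translation, which is neither loss-free-with-boundary-chart nor lossy), and
  **`single_free_not_mem_resVertex`** — THE THEOREM: FT (`FreeTailProof.noIsolatedFreeTailAt_self`) forbids it, so
  `e_{Y_k} ∉ resVertex (c k)` for every `k ≥ k₀`; `translation_unique_of_light` is the usable form (the kernel meets a line
  `e_x + K·e_Y` in at most one point).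
[cite: CossartJannsenSaito2020, Thm. 3.10(4), Thm. 3.14] bears_on: LADDER-RESOLUTION:D157-DOOR2 (res-dim4-pi · K2(p) · slice C
· light-lossy (5,3) = hN4-C · FILE 1).  Supports stmt-ResolutionOfSingularities-16155 (helper).
-/

set_option linter.dupNamespace false -- mandated namespace of this single-conjunct summit

noncomputable section

namespace Summit.ResolutionOfSingularities.ResolutionOfSingularities.Theorems.PIDim4

namespace ResCone

open MvPolynomial Finset
open Literature.AlgebraicGeometry.Resolution
open Literature.AlgebraicGeometry.Resolution.CentreBlowup
open Literature.AlgebraicGeometry.Resolution.Hauser2010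
open Literature.AlgebraicGeometry.Resolution.HauserPerlega2019
open PointBlowup (polarMap additiveSubspace direction)

variable {K : Type} [Field K]

/-! ## 1. Linear algebra in `K⁴` and light boundary bookkeeping -/

/-- A plane `V ≤ K⁴` through the coordinate vectors `e_a`, `e_c` (`a ≠ c`) meets the coordinate hyperplane `{w_a = 0}` in
the line `K·e_c`. [folklore] -/
theorem inf_hyperplane_eq_span_of_mem {V : Submodule K (Fin 4 → K)} (hV : Module.finrank K V = 2) {a c : Fin 4}
    (hac : a ≠ c) (ha : (Pi.single a 1 : Fin 4 → K) ∈ V) (hc : (Pi.single c 1 : Fin 4 → K) ∈ V) :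
    V ⊓ hyperplane a = K ∙ (Pi.single c 1 : Fin 4 → K) := by
  have hle : (K ∙ (Pi.single c 1 : Fin 4 → K)) ≤ V ⊓ hyperplane a := by
    rw [Submodule.span_singleton_le_iff_mem]
    exact Submodule.mem_inf.mpr ⟨hc, mem_hyperplane.mpr (by rw [Pi.single_eq_of_ne hac])⟩
  have hlt : V ⊓ hyperplane a < V := by
    refine lt_of_le_of_ne inf_le_left fun h => ?_
    have ha' : (Pi.single a 1 : Fin 4 → K) ∈ V ⊓ hyperplane a := by rw [h]; exact ha
    have := mem_hyperplane.mp (Submodule.mem_inf.mp ha').2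
    rw [Pi.single_eq_same] at this
    exact one_ne_zero this
  have h1 : Module.finrank K ↥(V ⊓ hyperplane a) < 2 := hV ▸ Submodule.finrank_lt_finrank_of_lt hlt
  have h2 : Module.finrank K ↥(K ∙ (Pi.single c 1 : Fin 4 → K)) = 1 :=
    finrank_span_singleton (by intro h; have := congrFun h c; simp at this)
  exact (Submodule.eq_of_le_of_finrank_le hle (by omega)).symm

/-- In the light branch (all weights `≤ 1`, total `3`) every letter other than a free one carries weight `1`. [folklore] -/
theorem apply_eq_one_of_light {r : Fin 4 →₀ ℕ} (h1 : ∀ i, r i ≤ 1) (hdeg : r.degree = 3) {y : Fin 4} (hy : r y = 0)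
    {i : Fin 4} (hiy : i ≠ y) : r i = 1 := by
  by_contra hne
  have hi0 : r i = 0 := by have := h1 i; omega
  have hle : r.degree ≤ ((Finset.univ.erase y).erase i).card := by
    rw [Finsupp.degree_eq_sum]
    calc ∑ t, r t = ∑ t ∈ (Finset.univ.erase y).erase i, r t := by
          rw [Finset.sum_erase _ hi0, Finset.sum_erase _ hy]
      _ ≤ ∑ t ∈ (Finset.univ.erase y).erase i, 1 := Finset.sum_le_sum fun t _ => h1 t
      _ = ((Finset.univ.erase y).erase i).card := by simp
  rw [Finset.card_erase_of_mem (Finset.mem_erase.mpr ⟨hiy, Finset.mem_univ _⟩),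
    Finset.card_erase_of_mem (Finset.mem_univ _), Finset.card_univ, Fintype.card_fin] at hle
  omega

/-- The direction of a step whose translation is supported on one letter `y`: `e_j + b_y·e_y`. [folklore] -/
theorem direction_eq_of_support {j y : Fin 4} {b : Fin 4 → K} (hbj : b j = 0) (hb : ∀ i, i ≠ y → b i = 0) :
    direction j b = (Pi.single j 1 : Fin 4 → K) + b y • (Pi.single y 1 : Fin 4 → K) := by
  funext i
  simp only [direction, Function.update_apply, Pi.add_apply, Pi.smul_apply, Pi.single_apply, smul_eq_mul]
  by_cases hij : i = j
  · subst hij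
    by_cases hjy : i = y
    · subst hjy; simp [hbj]
    · simp [hjy]
  · rw [if_neg hij, if_neg hij, zero_add]
    by_cases hiy : i = y
    · subst hiy; simp
    · rw [if_neg hiy, mul_zero]; exact hb i hiy

/-! ## 2. One step of the degenerate kernel -/

section Chain

variable [DecidableEq K]

/-- **ONE STEP OF A DEGENERATE KERNEL** (module docstring §2): on the light `(5,3)` binary-cone tail, if the free letter `y` of
`c k` (`(c k).r y = 0`) has `e_y ∈ resVertex (c k)`, then the free letter `y′` of `c (k+1)` has `e_{y′} ∈ resVertex (c (k+1))`
and `resVertex (c (k+1)) ∩ {w_{j k} = 0} = K·e_{y′}`. [OURS] [cite: CossartJannsenSaito2020, Thm. 3.14] -/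
theorem free_mem_resVertex_step {c : ℕ → State K} {j : ℕ → Fin 4} {b : ℕ → Fin 4 → K}
    (hc : ∀ k, IsIsolated 5 (c k).F ∧ Step0 5 (c k) (c (k + 1))) (hw : FreeTail.IsWitnessedChain 5 c j b)
    (hr0 : ∀ e ∈ (c 0).F.support, (c 0).r ≤ e) (hfloor : ∀ k, ordZero (c k).F ≠ 5) {k₀ : ℕ}
    (hshade : ∀ k, k₀ ≤ k → (c k).shade = ((3 : ℕ) : ℕ∞))
    (he : ∀ k, k₀ ≤ k → Module.finrank K (resVertex (c k)) = 2)
    (hlight : ∀ k, k₀ ≤ k → (∀ i, (c k).r i ≤ 1) ∧ (c k).r.degree = 3) {k : ℕ} (hk : k₀ ≤ k) {y : Fin 4}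
    (hy : (c k).r y = 0) (hyV : (Pi.single y 1 : Fin 4 → K) ∈ resVertex (c k)) :
    ∃ y' : Fin 4, (c (k + 1)).r y' = 0 ∧ (Pi.single y' 1 : Fin 4 → K) ∈ resVertex (c (k + 1)) ∧
      resVertex (c (k + 1)) ⊓ hyperplane (j k) = K ∙ (Pi.single y' 1 : Fin 4 → K) := by
  haveI : Fact (Nat.Prime 5) := ⟨by norm_num⟩
  obtain ⟨-, hlaw, hbj, -, -⟩ := three_weights_laws hc hw hr0 hfloor hshade
  have hI2 := chain_resVertex_step_inf_hyperplane_eq 5 hc hw hr0 hfloor hshade he hk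
  have hdir := chain_direction_mem_resVertex 5 hc hw hr0 hfloor hshade hk
  have hone : ∀ i, i ≠ y → (c k).r i = 1 := fun i hiy => apply_eq_one_of_light (hlight k hk).1 (hlight k hk).2 hy hiy
  rcases light_step_cases hc hw hr0 hfloor hshade hlight hk with ⟨hj1, hno⟩ | ⟨hj0, hdeg1⟩
  · -- loss-free step: the kernel is `⟨e_{j k}, e_y⟩`, the free letter stays `y`
    have hjy : j k ≠ y := fun h => by rw [h, hy] at hj1; exact zero_ne_one hj1
    have hb : ∀ i, i ≠ y → b k i = 0 := by
      intro i hiy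
      by_contra hbi
      have := hno i hbi
      rw [hone i hiy] at this
      exact one_ne_zero this
    have hej : (Pi.single (j k) 1 : Fin 4 → K) ∈ resVertex (c k) := by
      have h := Submodule.sub_mem _ hdir (Submodule.smul_mem _ (b k y) hyV)
      rwa [direction_eq_of_support (hbj k) hb, add_sub_cancel_right] at h
    have hinf := inf_hyperplane_eq_span_of_mem (he k hk) hjy hej hyV
    refine ⟨y, ?_, ?_, by rw [hI2, hinf]⟩
    · have h := law_apply (r := fun k => (c k).r) (hlaw k hk) y
      simp only [if_neg (Ne.symm hjy)] at h
      by_cases hby : b k y = 0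
      · rw [if_pos hby] at h; exact h.trans hy
      · rw [if_neg hby] at h; exact h
    · have h : (Pi.single y 1 : Fin 4 → K) ∈ resVertex (c (k + 1)) ⊓ hyperplane (j k) := by
        rw [hI2, hinf]; exact Submodule.mem_span_singleton_self _
      exact (Submodule.mem_inf.mp h).1
  · -- lossy step: `j k = y`, one boundary letter `x` translated; the kernel is `⟨e_y, e_x⟩`, the new free letter is `x`
    have hjy : j k = y := by
      by_contra h
      have := hone (j k) h
      rw [hj0] at this
      exact zero_ne_one this
    obtain ⟨x, hbx, hrx⟩ : ∃ x, b k x ≠ 0 ∧ (c k).r x = 1 := by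
      have hne : (c k).r.filter (fun i => ¬ b k i = 0) ≠ 0 := by
        intro h0; rw [h0, map_zero] at hdeg1; exact zero_ne_one hdeg1
      obtain ⟨x, hx⟩ := Finsupp.ne_iff.mp hne
      rw [Finsupp.filter_apply, Finsupp.coe_zero, Pi.zero_apply] at hx
      by_cases hbx : b k x = 0
      · rw [if_neg (not_not.mpr hbx)] at hx; exact absurd rfl hx
      · refine ⟨x, hbx, ?_⟩
        rw [if_pos hbx] at hx
        exact hone x (fun h => hx (by rw [h, hy]))
    obtain ⟨-, hothers, hx0, -⟩ := lossy_step_shape hc hw hr0 hfloor hshade hlight hk hbx hrx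
    have hxy : x ≠ y := fun h => hbx (by rw [h, ← hjy]; exact hbj k)
    have hb : ∀ i, i ≠ x → b k i = 0 := by
      intro i hix
      by_cases hiy : i = y
      · rw [hiy, ← hjy]; exact hbj k
      · by_contra hbi
        have := hothers i hix hbi
        rw [hone i hiy] at this
        exact one_ne_zero this
    have hex : (Pi.single x 1 : Fin 4 → K) ∈ resVertex (c k) := by
      have h := Submodule.sub_mem _ hdir hyV
      rw [hjy, direction_eq_of_support (hjy ▸ hbj k) hb, add_sub_cancel_left] at h
      have h' := Submodule.smul_mem _ (b k x)⁻¹ h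
      rwa [smul_smul, inv_mul_cancel₀ hbx, one_smul] at h'
    have hinf := inf_hyperplane_eq_span_of_mem (he k hk) (Ne.symm hxy) hyV hex
    refine ⟨x, hx0, ?_, by rw [hI2, hjy, hinf]⟩
    have h : (Pi.single x 1 : Fin 4 → K) ∈ resVertex (c (k + 1)) ⊓ hyperplane (j k) := by
      rw [hI2, hjy, hinf]; exact Submodule.mem_span_singleton_self _
    exact (Submodule.mem_inf.mp h).1

/-! ## 3. The degenerate tail is free — against FT -/

/-- **Persistence**: if the free letter of `c k` is a kernel vector, so is the free letter of every `c n`, `n ≥ k`. [OURS] -/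
theorem free_mem_resVertex_of_le {c : ℕ → State K} {j : ℕ → Fin 4} {b : ℕ → Fin 4 → K}
    (hc : ∀ k, IsIsolated 5 (c k).F ∧ Step0 5 (c k) (c (k + 1))) (hw : FreeTail.IsWitnessedChain 5 c j b)
    (hr0 : ∀ e ∈ (c 0).F.support, (c 0).r ≤ e) (hfloor : ∀ k, ordZero (c k).F ≠ 5) {k₀ : ℕ}
    (hshade : ∀ k, k₀ ≤ k → (c k).shade = ((3 : ℕ) : ℕ∞))
    (he : ∀ k, k₀ ≤ k → Module.finrank K (resVertex (c k)) = 2)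
    (hlight : ∀ k, k₀ ≤ k → (∀ i, (c k).r i ≤ 1) ∧ (c k).r.degree = 3) {k : ℕ} (hk : k₀ ≤ k) {y : Fin 4}
    (hy : (c k).r y = 0) (hyV : (Pi.single y 1 : Fin 4 → K) ∈ resVertex (c k)) {n : ℕ} (hn : k ≤ n) :
    ∃ y' : Fin 4, (c n).r y' = 0 ∧ (Pi.single y' 1 : Fin 4 → K) ∈ resVertex (c n) := by
  induction n, hn using Nat.le_induction with
  | base => exact ⟨y, hy, hyV⟩
  | succ n hkn ih =>
    obtain ⟨y₁, hy₁, hy₁V⟩ := ih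
    obtain ⟨y', hy', hy'V, -⟩ := free_mem_resVertex_step hc hw hr0 hfloor hshade he hlight (by omega) hy₁ hy₁V
    exact ⟨y', hy', hy'V⟩

/-- **No satellite step after a degenerate kernel**: a satellite direction would lie in
`resVertex (c (n+1)) ∩ {w_{j n} = 0} = K·e_{Y_{n+1}}`, i.e. be the free chart letter with NO translation — neither a loss-free step
(boundary chart) nor a lossy one (one boundary letter translated). [OURS] [cite: CossartJannsenSaito2020, Thm. 3.14] -/
theorem not_isSatellite_of_free_mem_resVertex {c : ℕ → State K} {j : ℕ → Fin 4} {b : ℕ → Fin 4 → K}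
    (hc : ∀ k, IsIsolated 5 (c k).F ∧ Step0 5 (c k) (c (k + 1))) (hw : FreeTail.IsWitnessedChain 5 c j b)
    (hr0 : ∀ e ∈ (c 0).F.support, (c 0).r ≤ e) (hfloor : ∀ k, ordZero (c k).F ≠ 5) {k₀ : ℕ}
    (hshade : ∀ k, k₀ ≤ k → (c k).shade = ((3 : ℕ) : ℕ∞))
    (he : ∀ k, k₀ ≤ k → Module.finrank K (resVertex (c k)) = 2)
    (hlight : ∀ k, k₀ ≤ k → (∀ i, (c k).r i ≤ 1) ∧ (c k).r.degree = 3) {k : ℕ} (hk : k₀ ≤ k) {y : Fin 4}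
    (hy : (c k).r y = 0) (hyV : (Pi.single y 1 : Fin 4 → K) ∈ resVertex (c k)) {n : ℕ} (hn : k ≤ n) :
    ¬ FreeTail.IsSatellite j b n := by
  haveI : Fact (Nat.Prime 5) := ⟨by norm_num⟩
  rintro ⟨hjj, hbn⟩
  obtain ⟨-, -, hbj, -, -⟩ := three_weights_laws hc hw hr0 hfloor hshade
  obtain ⟨y₁, hy₁, hy₁V⟩ := free_mem_resVertex_of_le hc hw hr0 hfloor hshade he hlight hk hy hyV hn
  obtain ⟨y', hy', -, hinf⟩ := free_mem_resVertex_step hc hw hr0 hfloor hshade he hlight (by omega) hy₁ hy₁V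
  -- the direction of step `n+1` lies in `resVertex (c (n+1)) ∩ {w_{j n} = 0} = K·e_{y'}`
  have hdir := chain_direction_mem_resVertex 5 hc hw hr0 hfloor hshade (show k₀ ≤ n + 1 by omega)
  have hmem : direction (j (n + 1)) (b (n + 1)) ∈ resVertex (c (n + 1)) ⊓ hyperplane (j n) := by
    refine Submodule.mem_inf.mpr ⟨hdir, mem_hyperplane.mpr ?_⟩
    rw [direction, Function.update_of_ne (Ne.symm hjj)]
    exact hbn
  rw [hinf, Submodule.mem_span_singleton] at hmem
  obtain ⟨t, ht⟩ := hmem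
  have hval := congrFun ht (j (n + 1))
  simp only [Pi.smul_apply, Pi.single_apply, smul_eq_mul, direction, Function.update_self] at hval
  have hjy' : j (n + 1) = y' := by
    by_contra h; rw [if_neg h, mul_zero] at hval; exact zero_ne_one hval
  -- so the chart letter of step `n+1` is free and nothing is translated
  have hb0 : ∀ i, b (n + 1) i = 0 := by
    intro i
    by_cases hi : i = j (n + 1)
    · rw [hi]; exact hbj (n + 1)
    · have h := congrFun ht i
      simp only [Pi.smul_apply, Pi.single_apply, smul_eq_mul, direction, Function.update_of_ne hi] at h
      rw [← hjy', if_neg hi, mul_zero] at h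
      exact h.symm
  rcases light_step_cases hc hw hr0 hfloor hshade hlight (show k₀ ≤ n + 1 by omega) with ⟨hj1, -⟩ | ⟨-, hdeg1⟩
  · rw [hjy', hy'] at hj1; exact zero_ne_one hj1
  · have h0 : ((c (n + 1)).r.filter (fun i => ¬ b (n + 1) i = 0)).degree = 0 :=
      degree_filter_not_eq_zero_iff.mpr fun i hi => absurd (hb0 i) hi
    rw [h0] at hdeg1
    exact zero_ne_one hdeg1

variable [CharP K 5]

/-- **THE FREE LETTER IS NEVER A KERNEL VECTOR ON A LIGHT `(5,3)` BINARY-CONE TAIL**: along an isolated above-floor witnessed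
`Step0 5` chain with `x^{r₀} ∣ F₀`, constant shade `3`, `e_G ≡ 2` and light boundary (`|r_k| = 3`, weights `≤ 1`) from `k₀`, for
every `k ≥ k₀` and the free letter `y` of `c k` (`(c k).r y = 0`): `e_y ∉ resVertex (c k)`.  (Otherwise every later step is free,
§3, and FT `FreeTailProof.noIsolatedFreeTailAt_self` produces a non-isolated state.)  Equivalently the polar kernel is never
the plane `⟨e_{hit}, e_{free}⟩`, so the loss-free re-presentation of the next centre is KERNEL-DETERMINED (FILES 2–4). [OURS]
[cite: CossartJannsenSaito2020, Thm. 3.10(4), Thm. 3.14] -/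
theorem single_free_not_mem_resVertex {c : ℕ → State K} {j : ℕ → Fin 4} {b : ℕ → Fin 4 → K}
    (hc : ∀ k, IsIsolated 5 (c k).F ∧ Step0 5 (c k) (c (k + 1))) (hw : FreeTail.IsWitnessedChain 5 c j b)
    (hr0 : ∀ e ∈ (c 0).F.support, (c 0).r ≤ e) (hfloor : ∀ k, ordZero (c k).F ≠ 5) {k₀ : ℕ}
    (hshade : ∀ k, k₀ ≤ k → (c k).shade = ((3 : ℕ) : ℕ∞))
    (he : ∀ k, k₀ ≤ k → Module.finrank K (resVertex (c k)) = 2)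
    (hlight : ∀ k, k₀ ≤ k → (∀ i, (c k).r i ≤ 1) ∧ (c k).r.degree = 3) {k : ℕ} (hk : k₀ ≤ k) {y : Fin 4}
    (hy : (c k).r y = 0) : (Pi.single y 1 : Fin 4 → K) ∉ resVertex (c k) := by
  haveI : Fact (Nat.Prime 5) := ⟨by norm_num⟩
  intro hyV
  obtain ⟨m, hm⟩ := FreeTailProof.noIsolatedFreeTailAt_self 5 K c j b k hw
    (fun n hn => not_isSatellite_of_free_mem_resVertex hc hw hr0 hfloor hshade he hlight hk hy hyV hn)
  exact hm (hc m).1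

/-- **Non-degeneracy, usable form**: on the light tail the polar kernel meets the line `e_x + K·e_y` (`y` free) in AT MOST ONE
point — two points would put `e_y` in the kernel. [OURS] -/
theorem translation_unique_of_light {c : ℕ → State K} {j : ℕ → Fin 4} {b : ℕ → Fin 4 → K}
    (hc : ∀ k, IsIsolated 5 (c k).F ∧ Step0 5 (c k) (c (k + 1))) (hw : FreeTail.IsWitnessedChain 5 c j b)
    (hr0 : ∀ e ∈ (c 0).F.support, (c 0).r ≤ e) (hfloor : ∀ k, ordZero (c k).F ≠ 5) {k₀ : ℕ}
    (hshade : ∀ k, k₀ ≤ k → (c k).shade = ((3 : ℕ) : ℕ∞))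
    (he : ∀ k, k₀ ≤ k → Module.finrank K (resVertex (c k)) = 2)
    (hlight : ∀ k, k₀ ≤ k → (∀ i, (c k).r i ≤ 1) ∧ (c k).r.degree = 3) {k : ℕ} (hk : k₀ ≤ k) {x y : Fin 4}
    (hy : (c k).r y = 0) {γ γ' : K}
    (hγ : (Pi.single x 1 : Fin 4 → K) + γ • (Pi.single y 1 : Fin 4 → K) ∈ resVertex (c k))
    (hγ' : (Pi.single x 1 : Fin 4 → K) + γ' • (Pi.single y 1 : Fin 4 → K) ∈ resVertex (c k)) : γ = γ' := by
  by_contra hne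
  have h := Submodule.sub_mem _ hγ hγ'
  rw [add_sub_add_left_eq_sub, ← sub_smul] at h
  have h' := Submodule.smul_mem _ (γ - γ')⁻¹ h
  rw [smul_smul, inv_mul_cancel₀ (sub_ne_zero.mpr hne), one_smul] at h'
  exact single_free_not_mem_resVertex hc hw hr0 hfloor hshade he hlight hk hy h'

end Chain

end ResCone

end Summit.ResolutionOfSingularities.ResolutionOfSingularities.Theorems.PIDim4

end
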